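import Literature.NumberTheory.Automorphic.Liu2021.AppendixC.HeckeTranslateLevelQuotient
import Literature.NumberTheory.Automorphic.Liu2021.AppendixC.AlbaneseTraceOfFiniteQuotientOfCocycle
import Literature.NumberTheory.Automorphic.Liu2021.AppendixC.BettiPinningHeckeEndomorphism
import Literature.NumberTheory.Automorphic.Liu2021.AppendixC.HeckeEndomorphismMul
import Literature.NumberTheory.Automorphic.Liu2021.AppendixC.RestOneLevelInvariants
import HarnessLib

/-!
# The (P3) INPUT PACKAGE of a Hecke generator `[Kγ₀K]`: a normal level `N`, the finite quotient action, the Albanese trace and a transversal,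
# PRODUCED from the level-quotient universal property (Liu 2021 §4.2 / App. C; Milne 2005 §5, §13; Lang VIII §6)

Topic `NumberTheory/Automorphic/Liu2021/AppendixC`; namespace `Literature.NumberTheory.Automorphic.Liu2021.AppendixC`.
PROOF FILE (theorems only; no definition, no named fact, no instance, no `sorry`).  Generic over a §4.2 datum `C : Sec42Data` with Hecke
translates `T : C.HeckeTranslates` over a reflex field `E ⊆ ℂ`.

★ (P3) `heckeEnd_eq_pushPull_of_aut` writes the Hecke endomorphism `[Kγ₀K] ∈ End⁰(A_K)` as the push–pull word
`(card Δ)⁻¹ · (t ≫ Σ_{γ ∈ s} Alb T_γ)` GIVEN: a level `N ≤ K` normalised by `K`, a finite non-empty family `act` of automorphisms of `X_N`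
which are translates `T_k` (`k ∈ K`), an Albanese trace `t : A_K → A_N` with `Alb_u ≫ t = Σ_δ Alb(act δ)`, and a transversal `s` of `Kγ₀K∕K`
with `γ⁻¹Nγ ⊆ K` on `s`.  This file PRODUCES that package from the level-quotient universal property `hUP` (the cell's ★
`levelQuotientUP_GS` shape) — together with the Galois structure of `u` that the piecewise trace word needs:

* **`exists_pushPull_package`** — `∃ N hNK hn Δ [Group Δ] [Fintype Δ] [Nonempty Δ] (act : Δ →* Aut X_N) hact (t, ht) (s, hs, hsN),
  IsSepQuotient (act ·) u`: the transversal by ★ `exists_transversal_level`, the level by ★ `C5.SmallLevel.exists_normal_le_forall_heckeLE`,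
  the finite translate action + quotient by ★ `exists_finite_isSepQuotient_map'`, the trace by ★ `Albanese.exists_trace_of_isSepQuotient_complex`
  ([Lang1983AbelianVarieties] VIII §6 Thm. 13) at the data `C.alb`;
* **`C5.SmallLevel.exists_normal_sublevel_conj`** — for `γ` and levels `N, K`: a level `N″ ≤ K`, NORMAL in
  `K`, with `γN″γ⁻¹ ⊆ N` (`HeckeLE γ⁻¹ N″ N`) — the normal sub-level `N″_γ` of the (L3) entry recipe (★ `C5.SmallLevel.exists_normal_le`
  below the conjugate level `γ⁻¹Nγ ∩ K₀ = heckeLevel γ⁻¹ N`).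

Cell `hodgecm-mathlib` (D-0151), crux `HLiu418` = stmt-HodgeConjecture-24832, d6 line, `stub_RosH` glue: (G1) of the (L) pen's
`obtain`-chain (A-p02 (g14) 2026-08-30T05:34Z∕05:47Z).  COUNT-NEUTRAL capital: HC_CM is proved only modulo the 7 printed citations until
rung 0 closes.

## References
* [Liu2021] Y. Liu, *Fourier–Jacobi cycles and arithmetic relative trace formula*, Camb. J. Math. 9 (2021): §4.2 (FJcycle.tex l. 2060–2074),
  p. 133 (before (D.3)).
* [Milne2005ShimuraVarieties] J. S. Milne, *Introduction to Shimura varieties* (2005), §5 p. 57 L7–12, p. 58 L3–11, Rem. 5.29 (c) p. 65;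
  §13 p. 118 L21–26.
* [Lang1983AbelianVarieties] S. Lang, *Abelian Varieties* (1983), Ch. VIII §6 Thm. 13 (pp. 224–227).
* [Bump1997] D. Bump, *Automorphic Forms and Representations* (1997), §4.2 Prop. 4.2.3.
-/

set_option autoImplicit false

noncomputable section

open CategoryTheory AlgebraicGeometry NumberField MulAction
open Literature.AlgebraicGeometry.Motives

namespace Literature.NumberTheory.Automorphic.Liu2021.AppendixC

/-! ## §1 The normal sub-level below a conjugate -/

namespace C5.SmallLevel

variable {H : Type} [Group H] [TopologicalSpace H] [IsTopologicalGroup H] {K₀ : OpenCompactSubgroup H}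

/-- **A normal sub-level conjugating into `N`**: for levels `N`, `K` and `γ` there is a level `N″ ≤ K`, normalised by `K`, with
`γN″γ⁻¹ ⊆ N` (`HeckeLE γ⁻¹ N″ N`): a normal open subgroup of the compact `K` inside the open `γ⁻¹Nγ ∩ K` (★ `exists_normal_le` below the
conjugate level `heckeLevel γ⁻¹ N = γ⁻¹Nγ ∩ K₀`).  The `N″_γ` of the (L3) entry recipe. [cite: Milne2005ShimuraVarieties, §13 p. 118 L21–26 and §5 p. 57 L7–12]
[cite: Liu2021, §4.2 (FJcycle.tex l. 2060–2074)] -/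
theorem exists_normal_sublevel_conj (N K : SmallLevel K₀) (γ : H) :
    ∃ N'' : SmallLevel K₀, N'' ≤ K ∧ (∀ k ∈ K.1.1, HeckeLE k N'' N'') ∧ HeckeLE γ⁻¹ N'' N := by
  obtain ⟨N'', hK, hM, hn⟩ := exists_normal_le K (heckeLevel γ⁻¹ N)
  exact ⟨N'', hK, hn, (heckeLE_heckeLevel γ⁻¹ N).of_le_left hM⟩

end C5.SmallLevel

/-! ## §2 The (P3) input package -/

section Sec42

variable {F E : Type} [Field F] [NumberField F] [IsTotallyReal F] [Field E] [NumberField E] [Algebra F E]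
  [IsTotallyComplex E] [Algebra.IsQuadraticExtension F E]
variable {P5 : PropC5Data F E} {isotropicAt : ℕ → Prop}

namespace Sec42Data.HeckeTranslates

variable {C : Sec42Data P5 isotropicAt} (T : C.HeckeTranslates)

/-- **THE (P3) INPUT PACKAGE OF A HECKE GENERATOR `[Kγ₀K]`, PRODUCED.**  Granted the level-quotient universal property at every normal
level pair (`hUP`, ★ `levelQuotientUP_GS`'s shape) and an embedding `τ : E →+* ℂ`: there are a level `N ≤ K` normalised by `K`, a FINITE
NON-EMPTY group `Δ` (= `K ∕ N`) acting on `X_N` by translates (`act : Δ →* Aut X_N`, every `act δ` is some `T_k`, `k ∈ K`), an Albanese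
trace `t : A_K → A_N` with `Alb_u ≫ t = Σ_δ Alb(act δ)` ([Lang1983AbelianVarieties] VIII §6 Thm. 13, ★ `Albanese.exists_trace_of_isSepQuotient_complex`),
a transversal `s` of `Kγ₀K ∕ K` with `γ⁻¹Nγ ⊆ K` for `γ ∈ s`, AND `u^N_K` is a quotient of `X_N` by `act` for separated test objects — verbatim
the binders of ★ (P3) `heckeEnd_eq_pushPull_of_aut` (with `act ·` as the bare family) plus the Galois clause the piecewise trace word consumes.
[cite: Liu2021, §4.2 (FJcycle.tex l. 2074) and p. 133 (before (D.3))] [cite: Lang1983AbelianVarieties, Ch. VIII §6, Thm. 13 (pp. 224–227)]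
[cite: Milne2005ShimuraVarieties, §5 p. 58 L3–11 and Rem. 5.29 (c) p. 65] [cite: Bump1997, §4.2 (Prop. 4.2.3)] -/
theorem exists_pushPull_package (τ : E →+* ℂ)
    (hUP : ∀ ⦃N₁ K₁ : C5.SmallLevel C.S.K₀⦄ (h₁ : N₁ ≤ K₁) (hn₁ : ∀ k ∈ K₁.1.1, C5.HeckeLE k N₁ N₁)
      (W : SchemeOver E) (f : C.X N₁ ⟶ W), IsSeparated W.hom →
      (∀ (k : C.G) (hk : k ∈ K₁.1.1), T.tr k N₁ N₁ (hn₁ k hk) ≫ f = f) → ∃! fbar : C.X K₁ ⟶ W, C.cpt.X.map (homOfLE h₁) ≫ fbar = f)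
    (K : C5.SmallLevel C.S.K₀) (γ₀ : C.G) :
    ∃ (N : C5.SmallLevel C.S.K₀) (hNK : N ≤ K) (hn : ∀ k ∈ K.1.1, C5.HeckeLE k N N)
      (Δ : Type) (_ : Group Δ) (_ : Fintype Δ) (_ : Nonempty Δ) (act : Δ →* Aut (C.X N))
      (_ : ∀ δ, ∃ (k : C.G) (hk : k ∈ K.1.1), (act δ).hom = T.tr k N N (hn k hk))
      (t : C.A K ⟶ C.A N)
      (_ : (C.alb N).map (C.alb K) (C.cpt.X.map (homOfLE hNK)) ≫ t = ∑ δ, (C.alb N).map (C.alb N) (act δ).hom)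
      (s : Finset C.G)
      (_ : Set.BijOn (fun x : C.G => (x : C.G ⧸ (K.1.1 : Subgroup C.G))) s (orbit K.1.1 (γ₀ : C.G ⧸ (K.1.1 : Subgroup C.G))))
      (_ : ∀ γ ∈ s, C5.HeckeLE γ N K),
      IsSepQuotient (fun δ => act δ) (C.cpt.X.map (homOfLE hNK)) := by
  classical
  -- the transversal and a normal level below all the conjugates
  obtain ⟨s, hs⟩ := exists_transversal_level (C := C) K γ₀
  obtain ⟨N, hNK, hn, hsN⟩ := C5.SmallLevel.exists_normal_le_forall_heckeLE s K
  -- the finite translate action with its quotient property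
  obtain ⟨Δ, instG, instF, act, hact, -, hq⟩ := T.exists_finite_isSepQuotient_map' hNK hn (hUP hNK hn)
  haveI : Nonempty Δ := ⟨1⟩
  -- the Albanese trace (Lang VIII §6 Thm. 13) at the data `C.alb`
  letI : Algebra E ℂ := τ.toAlgebra
  haveI := C.cpt.smooth_X N
  haveI := C.cpt.smooth_X K
  obtain ⟨t, ht⟩ := Albanese.exists_trace_of_isSepQuotient_complex (dX := P5.n - 1) (dY := P5.n - 1) (C.cpt.projective_X N)
    (C.cpt.projective_X K) act (C.cpt.X.map (homOfLE hNK)) hq (C.alb N) (C.alb K)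
  exact ⟨N, hNK, hn, Δ, instG, instF, inferInstance, act, hact, t, ht, s, hs, hsN, hq⟩

end Sec42Data.HeckeTranslates

end Sec42

end Literature.NumberTheory.Automorphic.Liu2021.AppendixC

end
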